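import Summits.QuantumFields.BalabanUV.Beta.D1BFx.GhostSqrtLegLimit
import Summits.QuantumFields.BalabanUV.Beta.D1BFx.GhostKernelComplete

/-!
# `BalabanUV.Beta.D1BFx.GhostSqrtLegPins` — road «BF-x» for binder row D1, slot (K), chain step (S-GH), «GH-DICT» PART 3:
# THE ONE-LEG MAIN TERM OF (S-GH) AT THE `ℋ`-PACKED GHOST JETS IS `2·PghQ n a (−1) n² 0` — THE PINS THAT FOLLOW THE OUTPUT

HONEST DEPENDENCY (page 1, mandatory): continuum YM on T⁴ ⇐ BetaPertH ∧ nine spine estimates (0/9 proved); BetaPertH ⇐ (D1) ∧ (D4) ∧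
CAP+tail; G-an2-4 gates asym, D1 and NE2/3/4.  HONEST FRAMING (cell contract, verbatim): «discharging `BetaPertH` makes Bałaban's UV
stability UNCONDITIONAL — a real constructive-QFT result; it is NOT the continuum limit and NOT the Clay problem.»  THIS MODULE DISCHARGES
NOTHING of the wall: [our object] pointwise algebra on the road's OWN definitions (`GhostStencilRooted.SghAt`, `GhostAveragingSquare.WghAt`,
`GhostKernelComplete.PghQ`, `ReducedKernelF.vertexRedF`, `ReducedTableF.tableRedF`, `TorusGhostPairStencils.gh₂`, `GhostStencilReflection.ghX`) +
[folklore] scalars through `tsum` + FILE 2's limit theorem BY NAME (`GhostSqrtLegLimit.tendsto_hessT_Cgh_biLaplacian`) with the packed jets'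
localisation letters BY NAME (`vertexFamily_vertexRedF'`, `vertexFamily₂_tableRedF'`, `biLoc_ghCur`, `biLoc_gh₂`).  No definition, no
`def … : Prop`, nothing cited, 0 sorry.  `PghQ` is the road's CHECK-N0 MODEL, NOT claimed to be Bałaban's kernel; the pins below are READ OFF the
algebra, not asserted of [B12].  0 root-level binders discharged (hW ∕ hR-sockets ∕ hSX-socket ∕ D1Tel ∕ D1Rep = 0); NOT (K), NOT D1, NOT
`BetaPertH`, NOT continuum, NOT Clay.

ABSOLUTE RULE (cell charter, verbatim): «No internally-minted statement may enter as a cited fact. Every hypothesis is either kernel-proved in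
this package or a verbatim quotation of a PUBLISHED theorem with page reference. The manuscript(s) under audit are NOT citable for their own
disputed steps — they are the thing under adjudication; programme-internal (2001/route/tribunal) claims are never citable.»

WHY (owner d1-p2, `DICT-CHAIN-SPEC.md` v1.2 §1 (S-GH); rulings ρ-g14-2 «the ghost pins of record FOLLOW GH-DICT's output (`PghQ` is a CHECK-N0 model;
`x₀ cK cQ` are free letters of every END)», ρ-g15-1 «PART 3: compare `2·hessKer (Ggh n a) 𝒱² 𝒲²` with `ωgh n·PghQ n a x₀ cK cQ` on the ray — state
what comes out, do not force the END's letters»).  FILE 2 (`GhostSqrtLegLimit`) reads the bi-Laplacian ghost functional of `(Cgh n a)^` on `ℤ⁴` as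
`2·(½·tadpole (Ggh n a) (n²•W) − ½·bubble (Ggh n a) (n²•V) (n²•V′)) − PRem` for ANY bi-localised jets.  On the road the jets are RESPONSE-PACKED
(ρ-g14-1: `ℋ`-superpositions of the fine stencils — `vertexOf`∕`vertexRedF` for first order, `tableRedF` for the mixed table; the ghost words inherit
the superposition by linearity of the first variation).  The road's ghost kernel is `PghQ n a x₀ cK cQ = hessKer (Ggh n a) (vertexRedF n (SghAt ρ_c n cK cQ))
(tableRedF n (WghAt ρ_c n x₀ cK cQ))` (`GhostKernelComplete.PghQ_eq_hessKer`) with `SghAt = cK•ghCur + cQ•qAntiAt` and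
`WghAt = diagExt ((x₀·cK)•ghX) + (−(x₀·cQ·n⁴))•qSqAt`.  THIS FILE:
* §1 [our object] `SghAt_cQ_zero`, `gh₂_eq_neg_ghX` (`gh₂ κ u = −ghX κ u` — the `L̂²` pair table IS minus the reversal-symmetric same-bond contact),
  `WghAt_cQ_zero`, **`SghAt_pins`** (`SghAt ρ n n² 0 = n²•ghCur`), **`WghAt_pins`** (`WghAt ρ n (−1) n² 0 κ v l v′ = n²•[v = v′ ∧ κ = l]•gh₂ κ v`).
* §2 [folklore] `vertexRedF_smul`, `tableRedF_smul`; [our object] **`mainTerm_packed_eq_two_mul_PghQ`**: at `V := vertexRedF n ghCur μ 0`,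
  `V′ := vertexRedF n ghCur ν z`, `W := tableRedF n gh₁₁ μ 0 ν z` the one-leg main term EQUALS `2·PghQ n a (−1) n² 0 μ ν z`;
  `mainTerm_packed_eq_ray_add_deltaGH` (ρ-g15-4 «ΔGHOST-AS-REST» display: `= 2·PghQ n a (−1) n² a + ΔGH`, `ΔGH := 2·(PghQ … 0 − PghQ … a)`).
* §3 [our object] **`tendsto_hessT_Cgh_biLaplacian_packed`**: FILE 2 §1 at these packed jets — the torus bi-Laplacian ghost functional of `(Cgh)^` over
  the words of their arrays CONVERGES to `2·PghQ n a (−1) n² 0 μ ν z − PRem(packed, n²-rescaled jets)`.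
READING — THE PINS THAT FOLLOW THE OUTPUT: loop weight `2`; `x₀ = −1`, `cK = n²` = the END's ray letters `x₀ := −cgh n`, `cK := cgh n·n²` AT `cgh = 1`;
**`cQ = 0`**, where the END's ray has `cQ := cgh n·a`: the averaging stencil `qAntiAt`∕`qSqAt` does NOT enter the ONE-LEG main term — the averaging
weight `a` enters (S-GH) only through the leg `Ggh n a` and the `Pgt n a`-words of `PRem` (`Pgt` is built from `Q′`, `G′`, `Csq`).  Whether the
`cQ`-part of the END's `PghQ` is (part of) `PRem` is NOT decided here; by leaf-01 g20's F-d1leaf01-g20-1 `PRem` has TWELVE non-cancelling two-leg words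
(the two `V·V′` tadpole-shaped slots cancel two single-`P` slots identically), to be named `RestKernelGhostWords.ghostWord` («RK-GH-WORDS»).
WHAT THIS FILE DOES NOT DO: it does not prove that «(A1)-PACKED»'s ghost slot IS the functional at these packed jets (leaf-03's brick; displayed here
as the instantiation), and it asserts nothing about Bałaban's (1.22) coefficients.
Unit `b2b-balaban-beta-d1-formalise-leaf-04` (gen 17), D1 formalisation swarm; journal INTENT [D1LEAF04-G17-INTENT-2].
-/

noncomputable section

namespace Summit.QuantumFields.BalabanUV.Beta.D1BFx.GhostSqrtLegPins

open Matrix Filter Topology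
open scoped BigOperators
open Literature.MathematicalPhysics.QuantumFieldTheory.Balaban1983to89
open Literature.MathematicalPhysics.QuantumFieldTheory.Balaban1983to89.Beta
open ExpKernelCalculus (MKer Decays BiLoc comp tr bubble tadpole hessKer VertexFamily VertexFamily₂)
open AffineAveraging (unitVec)
open OneStepResolventKernel (wsum)
open Summit.QuantumFields.BalabanUV.Beta.TameKernelCalculus (biLoc_of_le)
open Summit.QuantumFields.BalabanUV.Beta.D1BFx.FibredPeriodisation (periodiseF)
open Summit.QuantumFields.BalabanUV.Beta.D1BFx.PeriodicArrays (arr toF)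
open Summit.QuantumFields.BalabanUV.Beta.D1BFx.MixedVarPackedHess (hessT)
open Summit.QuantumFields.BalabanUV.Beta.D1BFx.RProjector (Pgt)
open Summit.QuantumFields.BalabanUV.Beta.D1BFx.GhostLeg (Ggh)
open Summit.QuantumFields.BalabanUV.Beta.D1BFx.GhostStencil (ghCur biLoc_ghCur)
open Summit.QuantumFields.BalabanUV.Beta.D1BFx.GhostStencilReflection (ghX ghX_apply)
open Summit.QuantumFields.BalabanUV.Beta.D1BFx.GhostStencilRooted (SghAt SghAt_apply)
open Summit.QuantumFields.BalabanUV.Beta.D1BFx.GhostStencilRootedReflection (ctrHalf)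
open Summit.QuantumFields.BalabanUV.Beta.D1BFx.GhostAveragingSquare (WghAt WghAt_eq)
open Summit.QuantumFields.BalabanUV.Beta.D1BFx.ReducedKernelSandwichBlock (diagExt diagExt_apply)
open Summit.QuantumFields.BalabanUV.Beta.D1BFx.ReducedKernelF (vertexRedF vertexFamily_vertexRedF')
open Summit.QuantumFields.BalabanUV.Beta.D1BFx.ReducedTableF (tableRedF vertexFamily₂_tableRedF')
open Summit.QuantumFields.BalabanUV.Beta.D1BFx.GhostKernelComplete (PghQ PghQ_eq_hessKer)
open Summit.QuantumFields.BalabanUV.Beta.D1BFx.KGhostLeg (Cgh)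
open Summit.QuantumFields.BalabanUV.Beta.D1BFx.TorusGhostWordArrays (lapU)
open Summit.QuantumFields.BalabanUV.Beta.D1BFx.TorusJetArrays (ptPair ptPair_apply)
open Summit.QuantumFields.BalabanUV.Beta.D1BFx.TorusGhostPairStencils (gh₂ biLoc_gh₂ biLoc_zero_of_nonneg)
open Summit.QuantumFields.BalabanUV.Beta.D1BFx.GhostSqrtLegLimit (tendsto_hessT_Cgh_biLaplacian)

/-! ## §1 The completed ghost tables at `cQ = 0`; `gh₂ = −ghX`; the pins `(x₀, cK, cQ) = (−1, n², 0)` -/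

section Tables

variable (ρ : Fin 4 → ℤ) (n : ℕ)

/-- [our object] At `cQ = 0` the rooted first-order ghost stencil is the bare current: `SghAt ρ n cK 0 κ u = cK • ghCur κ u`. -/
theorem SghAt_cQ_zero (cK : ℝ) (κ : Fin 4) (u : Fin 4 → ℤ) : SghAt ρ n cK 0 κ u = cK • ghCur κ u := by
  funext x z a b
  rw [SghAt_apply, Pi.smul_apply, Pi.smul_apply, Pi.smul_apply, Pi.smul_apply, smul_eq_mul, zero_mul, add_zero]

/-- [our object] **THE `L̂²` PAIR TABLE IS MINUS THE REVERSAL-SYMMETRIC SAME-BOND CONTACT**: `gh₂ κ u = −ghX κ u`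
(`gh₂ = −(ptPair u (u+e) + ptPair (u+e) u)`, `ghX = [x = u+e ∧ z = u] + [x = u ∧ z = u+e]`). -/
theorem gh₂_eq_neg_ghX (κ : Fin 4) (u : Fin 4 → ℤ) : gh₂ κ u = -ghX κ u := by
  funext x z a b
  simp only [gh₂, Pi.neg_apply, Pi.add_apply, ptPair_apply, ghX_apply]
  rw [add_comm]

/-- [our object] At `cQ = 0` the completed two-bond table is the bond-diagonal contact alone:
`WghAt ρ n x₀ cK 0 κ v l v′ = [κ = l ∧ v = v′]•(x₀·cK)•ghX κ v`. -/
theorem WghAt_cQ_zero (x₀ cK : ℝ) (κ : Fin 4) (v : Fin 4 → ℤ) (l : Fin 4) (v' : Fin 4 → ℤ) :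
    WghAt ρ n x₀ cK 0 κ v l v' = if κ = l ∧ v = v' then (x₀ * cK) • ghX κ v else 0 := by
  rw [WghAt_eq, mul_zero, zero_mul, neg_zero, zero_smul, add_zero]
  rfl

/-- [our object] **THE PINS `(x₀, cK, cQ) = (−1, n², 0)`, FIRST ORDER**: `SghAt ρ n n² 0 κ u = n² • ghCur κ u`. -/
theorem SghAt_pins (κ : Fin 4) (u : Fin 4 → ℤ) : SghAt ρ n (((n : ℝ) ^ 2)) 0 κ u = (((n : ℝ) ^ 2)) • ghCur κ u :=
  SghAt_cQ_zero ρ n _ κ u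

/-- [our object] **THE PINS, SECOND ORDER**: `WghAt ρ n (−1) n² 0 κ v l v′ = n² • ([v = v′ ∧ κ = l]•gh₂ κ v)` — the completed table at the pins IS
PART 2b's mixed ghost table of record. -/
theorem WghAt_pins (κ : Fin 4) (v : Fin 4 → ℤ) (l : Fin 4) (v' : Fin 4 → ℤ) :
    WghAt ρ n (-1) (((n : ℝ) ^ 2)) 0 κ v l v' = (((n : ℝ) ^ 2)) • (if v = v' ∧ κ = l then gh₂ κ v else 0) := by
  rw [WghAt_cQ_zero]
  by_cases h : κ = l ∧ v = v'
  · rw [if_pos h, if_pos ⟨h.2, h.1⟩, gh₂_eq_neg_ghX, smul_neg, ← neg_smul, neg_mul, one_mul]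
  · rw [if_neg h, if_neg (fun h' => h ⟨h'.2, h'.1⟩), smul_zero]

end Tables

/-! ## §2 Scalars pass through the `ℋ`-packing; the one-leg main term at packed jets IS `2·PghQ n a (−1) n² 0` -/

section Packed

variable (n : ℕ) [NeZero n] (a : ℝ)

/-- [folklore] Scalars pass through the packed first-order vertex: `vertexRedF n (c•S) μ y = c • vertexRedF n S μ y` (`tsum_mul_left`; no summability). -/
theorem vertexRedF_smul (c : ℝ) (S : Fin 4 → (Fin 4 → ℤ) → MKer 4 Unit) (μ : Fin 4) (y : Fin 4 → ℤ) :
    vertexRedF n (fun κ u => c • S κ u) μ y = c • vertexRedF n S μ y := by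
  funext x z a' b
  simp only [vertexRedF, wsum, Pi.smul_apply, smul_eq_mul, Finset.mul_sum]
  refine Finset.sum_congr rfl fun κ' _ => ?_
  rw [← tsum_mul_left]
  exact tsum_congr fun u => by ring

/-- [folklore] Scalars pass through the packed second-order table: `tableRedF n (c•T) μ y ν y′ = c • tableRedF n T μ y ν y′`. -/
theorem tableRedF_smul (c : ℝ) (T : Fin 4 → (Fin 4 → ℤ) → Fin 4 → (Fin 4 → ℤ) → MKer 4 Unit) (μ : Fin 4) (y : Fin 4 → ℤ) (ν : Fin 4)
    (y' : Fin 4 → ℤ) : tableRedF n (fun κ u l u' => c • T κ u l u') μ y ν y' = c • tableRedF n T μ y ν y' := by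
  funext x z a' b
  simp only [tableRedF, wsum, Pi.smul_apply, smul_eq_mul, Finset.mul_sum, ← tsum_mul_left]
  exact Finset.sum_congr rfl fun κ' _ => Finset.sum_congr rfl fun l' _ => tsum_congr fun u => tsum_congr fun u' => by ring

/-- [our object] **GH-DICT PART 3 — THE ONE-LEG MAIN TERM OF (S-GH) AT THE `ℋ`-PACKED GHOST JETS IS `2·PghQ` AT THE PINS `(x₀, cK, cQ) = (−1, n², 0)`.**
With the packed first jets `vertexRedF n ghCur` (the `ℋ`-column superposition of the fine ghost currents, `ReducedKernelF.vertexRedF`) and the packed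
mixed table `tableRedF n gh₁₁` (`gh₁₁ κ u l u′ := [u = u′ ∧ κ = l]•gh₂ κ u`), the `ℤ⁴` main term of `GhostSqrtLegLimit.tendsto_hessT_Cgh_biLaplacian`
— `2·(½·tadpole (Ggh n a) (n²•W) − ½·bubble (Ggh n a) (n²•V) (n²•V′))` at `V := vertexRedF n ghCur μ 0`, `V′ := vertexRedF n ghCur ν z`,
`W := tableRedF n gh₁₁ μ 0 ν z` — EQUALS `2·PghQ n a (−1) n² 0 μ ν z` (`GhostKernelComplete.PghQ_eq_hessKer` + §1's pins + scalars through the packing).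
READING (ρ-g14-2 ∕ ρ-g15-1 «the pins FOLLOW the output»): loop weight `2`; generator weight `x₀ = −1`, kinetic stencil weight `cK = n²` — the END's ray
letters `x₀ := −cgh`, `cK := cgh·n²` AT `cgh = 1`; averaging stencil weight **`cQ = 0`** (the END's ray has `cQ := cgh·a`): the `Q′*Q′`-jets `qAntiAt`∕`qSqAt`
do NOT enter the one-leg main term — the averaging weight `a` sits in the leg `Ggh n a` and in the sixteen `Pgt`-words (`Pgt` = the road's projector,
built from `Q′` and `G′`).  Nothing is asserted about those words here. -/
theorem mainTerm_packed_eq_two_mul_PghQ (μ ν : Fin 4) (z : Fin 4 → ℤ) :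
    2 * ((1 / 2) * tadpole (Ggh n a) (((n : ℝ) ^ 2) • tableRedF n (fun κ u l u' => if u = u' ∧ κ = l then gh₂ κ u else 0) μ 0 ν z)
        - (1 / 2) * bubble (Ggh n a) (((n : ℝ) ^ 2) • vertexRedF n (fun κ u => ghCur κ u) μ 0) (((n : ℝ) ^ 2) • vertexRedF n (fun κ u => ghCur κ u) ν z))
      = 2 * PghQ n a (-1) (((n : ℝ) ^ 2)) 0 μ ν z := by
  have hS : SghAt (ctrHalf n) n (((n : ℝ) ^ 2)) 0 = fun κ u => ((n : ℝ) ^ 2) • ghCur κ u := by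
    funext κ u; exact SghAt_pins _ n κ u
  have hW : WghAt (ctrHalf n) n (-1) (((n : ℝ) ^ 2)) 0 = fun κ v l v' => ((n : ℝ) ^ 2) • (if v = v' ∧ κ = l then gh₂ κ v else 0) := by
    funext κ v l v'; exact WghAt_pins _ n κ v l v'
  rw [PghQ_eq_hessKer, hS, hW, hessKer, vertexRedF_smul, vertexRedF_smul, tableRedF_smul]

/-- [our object] **«ΔGHOST-AS-REST» DISPLAY (owner ruling ρ-g15-4): THE SAME MAIN TERM READ AGAINST THE END's RAY.**  The END keeps its ghost model ON THE RAY
`(x₀, cK, cQ) = (−cgh, cgh·n², cgh·a)` (its ghost Ward rows need the full current `cK•ghCur + cQ•qAntiAt`); at `cgh = 1` the one-leg main term is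
`2·PghQ n a (−1) n² a + ΔGH` with **`ΔGH := 2·(PghQ n a (−1) n² 0 − PghQ n a (−1) n² a)`** = minus the `cQ`-sector of the ray model (the `ghCur ⊗ qAntiAt`
cross bubbles, the `qAntiAt ⊗ qAntiAt` bubble, the `qSqAt` tadpole), which joins the rest kernels next to the twelve `Pgt`-words (add and subtract; nothing
else is claimed — whether the `Pgt`-words already contain this sector is the OWNER's Q-GH-3). -/
theorem mainTerm_packed_eq_ray_add_deltaGH (μ ν : Fin 4) (z : Fin 4 → ℤ) :
    2 * ((1 / 2) * tadpole (Ggh n a) (((n : ℝ) ^ 2) • tableRedF n (fun κ u l u' => if u = u' ∧ κ = l then gh₂ κ u else 0) μ 0 ν z)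
        - (1 / 2) * bubble (Ggh n a) (((n : ℝ) ^ 2) • vertexRedF n (fun κ u => ghCur κ u) μ 0) (((n : ℝ) ^ 2) • vertexRedF n (fun κ u => ghCur κ u) ν z))
      = 2 * PghQ n a (-1) (((n : ℝ) ^ 2)) a μ ν z + 2 * (PghQ n a (-1) (((n : ℝ) ^ 2)) 0 μ ν z - PghQ n a (-1) (((n : ℝ) ^ 2)) a μ ν z) := by
  rw [mainTerm_packed_eq_two_mul_PghQ]
  ring

end Packed

/-! ## §3 The `ℤ⁴` reading at the packed ghost jets: `→ 2·PghQ n a (−1) n² 0 − (sixteen packed rest words)` -/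

section PackedLimit

variable (n : ℕ) [NeZero n] (a : ℝ) {p : ℕ → ℕ} [∀ k, NeZero (p k)]

omit [NeZero n] [∀ k, NeZero (p k)] in
/-- [folklore] The mixed ghost table `gh₁₁` is bi-localised at its own bonds, rate `δ′`, constant `exp δ′ + exp δ′`. -/
theorem biLoc_gh₁₁' (δ' : ℝ) (κ : Fin 4) (u : Fin 4 → ℤ) (l : Fin 4) (u' : Fin 4 → ℤ) :
    BiLoc (if u = u' ∧ κ = l then gh₂ κ u else 0) u u' (Real.exp δ' + Real.exp δ') δ' := by
  by_cases h : u = u' ∧ κ = l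
  · rw [if_pos h, ← h.1]; exact biLoc_gh₂ κ u δ'
  · rw [if_neg h]; exact biLoc_zero_of_nonneg u u' (by positivity) δ'

/-- [our object] **GH-DICT PART 3 — THE `ℤ⁴` READING OF (S-GH) AT THE `ℋ`-PACKED GHOST JETS.**  IF the ghost slot of «(A1)-PACKED» is the torus
bi-Laplacian functional of `(Cgh n a)^` over the words of the arrays of the PACKED ghost jets `V := vertexRedF n ghCur μ 0`, `V′ := vertexRedF n ghCur ν z`,
`W := tableRedF n gh₁₁ μ 0 ν z` (ρ-g14-1: response-packed jets are `ℋ`-superpositions of the fine stencils; the ghost words inherit the superposition by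
linearity — the instantiation is DISPLAYED here, not asserted of leaf-03's brick), THEN its `ℤ⁴` reading along `Site 4 (n·p_k)`, `p_k → ∞`, is
`2·PghQ n a (−1) n² 0 μ ν z − (the sixteen ℤ⁴ rest words of GhostSqrtLegLimit §1 at the packed, n²-rescaled jets)`
(`GhostSqrtLegLimit.tendsto_hessT_Cgh_biLaplacian` at these jets — bi-localised by `vertexFamily_vertexRedF'`∕`vertexFamily₂_tableRedF'` — and §2). -/
theorem tendsto_hessT_Cgh_biLaplacian_packed (ha : 0 < a) (hp : Tendsto p atTop atTop) (μ ν : Fin 4) (z : Fin 4 → ℤ) :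
    Tendsto (fun k => hessT (Matrix.of (periodiseF (n * p k) (toF (Cgh n a))))
        (Matrix.of (periodiseF (n * p k) (toF (arr (n * p k) (vertexRedF n (fun κ u => ghCur κ u) μ 0)))) * Matrix.of (periodiseF (n * p k) (toF lapU))
          + Matrix.of (periodiseF (n * p k) (toF lapU)) * Matrix.of (periodiseF (n * p k) (toF (arr (n * p k) (vertexRedF n (fun κ u => ghCur κ u) μ 0)))))
        (Matrix.of (periodiseF (n * p k) (toF (arr (n * p k) (vertexRedF n (fun κ u => ghCur κ u) ν z)))) * Matrix.of (periodiseF (n * p k) (toF lapU))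
          + Matrix.of (periodiseF (n * p k) (toF lapU)) * Matrix.of (periodiseF (n * p k) (toF (arr (n * p k) (vertexRedF n (fun κ u => ghCur κ u) ν z)))))
        (Matrix.of (periodiseF (n * p k) (toF (arr (n * p k) (tableRedF n (fun κ u l u' => if u = u' ∧ κ = l then gh₂ κ u else 0) μ 0 ν z)))) * Matrix.of (periodiseF (n * p k) (toF lapU))
          + Matrix.of (periodiseF (n * p k) (toF (arr (n * p k) (vertexRedF n (fun κ u => ghCur κ u) μ 0)))) * Matrix.of (periodiseF (n * p k) (toF (arr (n * p k) (vertexRedF n (fun κ u => ghCur κ u) ν z))))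
          + Matrix.of (periodiseF (n * p k) (toF (arr (n * p k) (vertexRedF n (fun κ u => ghCur κ u) ν z)))) * Matrix.of (periodiseF (n * p k) (toF (arr (n * p k) (vertexRedF n (fun κ u => ghCur κ u) μ 0))))
          + Matrix.of (periodiseF (n * p k) (toF lapU)) * Matrix.of (periodiseF (n * p k) (toF (arr (n * p k) (tableRedF n (fun κ u l u' => if u = u' ∧ κ = l then gh₂ κ u else 0) μ 0 ν z)))))) atTop
      (𝓝 (2 * PghQ n a (-1) (((n : ℝ) ^ 2)) 0 μ ν z
        - ((1 / 2) * (tr (comp (comp (Pgt n a) (Ggh n a)) (((n : ℝ) ^ 2) • tableRedF n (fun κ u l u' => if u = u' ∧ κ = l then gh₂ κ u else 0) μ 0 ν z))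
            + tr (comp (comp (Ggh n a) (Pgt n a)) (((n : ℝ) ^ 2) • tableRedF n (fun κ u l u' => if u = u' ∧ κ = l then gh₂ κ u else 0) μ 0 ν z))
            + tr (comp (comp (comp (Ggh n a) (comp (Pgt n a) (Ggh n a))) (((n : ℝ) ^ 2) • vertexRedF n (fun κ u => ghCur κ u) μ 0)) (((n : ℝ) ^ 2) • vertexRedF n (fun κ u => ghCur κ u) ν z))
            + tr (comp (comp (comp (Ggh n a) (comp (Pgt n a) (Ggh n a))) (((n : ℝ) ^ 2) • vertexRedF n (fun κ u => ghCur κ u) ν z)) (((n : ℝ) ^ 2) • vertexRedF n (fun κ u => ghCur κ u) μ 0)))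
          - (1 / 2) * (tr (comp (comp (Ggh n a) (((n : ℝ) ^ 2) • vertexRedF n (fun κ u => ghCur κ u) μ 0)) (comp (comp (Pgt n a) (Ggh n a)) (((n : ℝ) ^ 2) • vertexRedF n (fun κ u => ghCur κ u) ν z)))
            + tr (comp (comp (comp (Pgt n a) (Ggh n a)) (((n : ℝ) ^ 2) • vertexRedF n (fun κ u => ghCur κ u) μ 0)) (comp (Ggh n a) (((n : ℝ) ^ 2) • vertexRedF n (fun κ u => ghCur κ u) ν z)))
            + tr (comp (comp (comp (Ggh n a) (Ggh n a)) (((n : ℝ) ^ 2) • vertexRedF n (fun κ u => ghCur κ u) μ 0)) (comp (Pgt n a) (((n : ℝ) ^ 2) • vertexRedF n (fun κ u => ghCur κ u) ν z)))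
            + tr (comp (comp (comp (Ggh n a) (comp (Pgt n a) (Ggh n a))) (((n : ℝ) ^ 2) • vertexRedF n (fun κ u => ghCur κ u) μ 0)) (((n : ℝ) ^ 2) • vertexRedF n (fun κ u => ghCur κ u) ν z))
            + tr (comp (comp (comp (Ggh n a) (comp (Pgt n a) (Ggh n a))) (((n : ℝ) ^ 2) • vertexRedF n (fun κ u => ghCur κ u) ν z)) (((n : ℝ) ^ 2) • vertexRedF n (fun κ u => ghCur κ u) μ 0))
            + tr (comp (comp (Pgt n a) (((n : ℝ) ^ 2) • vertexRedF n (fun κ u => ghCur κ u) μ 0)) (comp (comp (Ggh n a) (Ggh n a)) (((n : ℝ) ^ 2) • vertexRedF n (fun κ u => ghCur κ u) ν z)))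
            + tr (comp (comp (Ggh n a) (((n : ℝ) ^ 2) • vertexRedF n (fun κ u => ghCur κ u) μ 0)) (comp (comp (Ggh n a) (Pgt n a)) (((n : ℝ) ^ 2) • vertexRedF n (fun κ u => ghCur κ u) ν z)))
            + tr (comp (comp (comp (Ggh n a) (Pgt n a)) (((n : ℝ) ^ 2) • vertexRedF n (fun κ u => ghCur κ u) μ 0)) (comp (Ggh n a) (((n : ℝ) ^ 2) • vertexRedF n (fun κ u => ghCur κ u) ν z))))
          + (1 / 2) * (tr (comp (comp (comp (Pgt n a) (Ggh n a)) (((n : ℝ) ^ 2) • vertexRedF n (fun κ u => ghCur κ u) μ 0)) (comp (comp (Pgt n a) (Ggh n a)) (((n : ℝ) ^ 2) • vertexRedF n (fun κ u => ghCur κ u) ν z)))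
            + tr (comp (comp (comp (Ggh n a) (comp (Pgt n a) (Ggh n a))) (((n : ℝ) ^ 2) • vertexRedF n (fun κ u => ghCur κ u) μ 0)) (comp (Pgt n a) (((n : ℝ) ^ 2) • vertexRedF n (fun κ u => ghCur κ u) ν z)))
            + tr (comp (comp (Pgt n a) (((n : ℝ) ^ 2) • vertexRedF n (fun κ u => ghCur κ u) μ 0)) (comp (comp (Ggh n a) (comp (Pgt n a) (Ggh n a))) (((n : ℝ) ^ 2) • vertexRedF n (fun κ u => ghCur κ u) ν z)))
            + tr (comp (comp (comp (Ggh n a) (Pgt n a)) (((n : ℝ) ^ 2) • vertexRedF n (fun κ u => ghCur κ u) μ 0)) (comp (comp (Ggh n a) (Pgt n a)) (((n : ℝ) ^ 2) • vertexRedF n (fun κ u => ghCur κ u) ν z))))))) := by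
  -- the packed jets are bi-localised at the coarse bonds, at a common rate
  obtain ⟨Cv, δv, hδv, -, hV⟩ := vertexFamily_vertexRedF' n (S := fun κ u => ghCur κ u) (fun κ' u => biLoc_ghCur κ' u 1) one_pos
  obtain ⟨Cw, δw, hδw, -, hW⟩ :=
    vertexFamily₂_tableRedF' n (Wf := fun κ u l u' => if u = u' ∧ κ = l then gh₂ κ u else 0) (fun κ' u l' u' => biLoc_gh₁₁' 1 κ' u l' u') one_pos
  have hδ : 0 < min δv δw := lt_min hδv hδw
  have h := tendsto_hessT_Cgh_biLaplacian n a ha (biLoc_of_le (hV μ 0) (min_le_left δv δw)) (biLoc_of_le (hV ν z) (min_le_left δv δw))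
    (biLoc_of_le (hW μ 0 ν z) (min_le_right δv δw)) hδ hp
  rw [mainTerm_packed_eq_two_mul_PghQ n a μ ν z] at h
  exact h

end PackedLimit

end Summit.QuantumFields.BalabanUV.Beta.D1BFx.GhostSqrtLegPins

end
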